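import Mathlib
import HarnessLib
import Summits.HubbardSuperconductivity.HubbardSuperconductivity.Theorems.KLProgrammeC4aPartnerBandTangencyLower
import Summits.HubbardSuperconductivity.HubbardSuperconductivity.Theorems.KLProgrammeC4aTangencyCalculusTwo
import Summits.HubbardSuperconductivity.HubbardSuperconductivity.Theorems.KLProgrammeC4aRadialRowsTwoThree
import Summits.HubbardSuperconductivity.HubbardSuperconductivity.Theorems.KLProgrammeC4aPathRigidity

/-!
# Route `KLProgramme` — crux C4a, S3 (B4)-(T) — FOLD-WINDOW CALCULUS, the CURVATURE-FLOOR INSTANCE («(B4)-TAN-FOLD», part 5): the loop-angle second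
# derivative of the partner band near the tangency configurations is `2·b_T(θ)` up to a Lipschitz error,
# `|∂_φ² ē − 2b_T(θ)| ≤ L(|φ|, |e|, ‖X − 2Φ(0,θ)‖)`, hence `∂_φ² ē ≥ (3/100)·u_min² − L` under `FrameOK` — the hypothesis `g″ ≥ 2b` of
# `…C4aFoldLevelSets` / `…C4aFoldSubstitution` BY NAME

Cell `gate-hubbard-kl`, seat hubbard-kl-k3c3-p3 (g21; row «implicit-function / monotonicity route»); helper for stub (C) `stub_twoLeg_curvature` of the
engine-flow child `KLRegimeEngineV17F2` (stmt-HubbardSuperconductivity-20437); memo HOME/hubbard-kl-c4a-1/C4A-PLAN.md §24.4 (ii), §24.8 (i) («the SECOND-ORDER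
COEFFICIENT, not just the bound: `ē(0,φ;0,0,θ) = b_T(θ)·φ² + O(|φ|³)`, `b_T = D²f(Γ)[Γ′,Γ′] = −Df(Γ)[Γ″]`»), §24.9.  The partner band in the loop angle is
`φ ↦ f(X − Γ_e(φ + θ))` with `f = e_K` (`frameLevel μ K`), `Γ_e = Φ(e,·)` (`levelPoint μ K e`) and `X = S_{ρϑθ}(0)` (pp) or `X = D_{ρϑθ}(0)` (ph, after `e_K` even);
by the chain rule `∂_φ² = D²f(p)[Γ_e′, Γ_e′] − Df(p)[Γ_e″]` at `p = X − Γ_e(φ+θ)`, and at the reference 2-jet (`p = Φ(0,θ)`, `Γ₀′(θ)`, `Γ₀″(θ)`) this is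
`b_T − (−b_T) = 2b_T` because `(f∘Γ₀)″ = D²f[Γ₀′,Γ₀′] + Df[Γ₀″] = 0` on the Fermi curve.  The comparison of the two 2-jets is the lane's one workhorse
`…C4aTangencyCalculusTwo.abs_jet_two_sub_le`; the displacements are the landed rows: `‖X − 2Φ(0,θ)‖` (`norm_pairDiffPath_zero_le` / `norm_pairSumPath_zero_le`),
`|e|/d` (`norm_levelPoint_sub_levelPoint_le`), `D_{j+1}|φ|` (`norm_iteratedDeriv_levelPoint_sub_le_angle`), `RR₁|e|` (`norm_iteratedDeriv_one_levelPoint_sub_le`),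
`C₂row|e|` (`norm_iteratedDeriv_two_levelPoint_sub_le`).

* §1 (carrier-free) `iteratedDeriv_two_comp_const_sub_shift` (the chain expression), `fderiv_two_add_fderiv_levelCurve_eq_zero` (`(f∘Γ₀)″ = 0`),
  **`abs_iteratedDeriv_two_comp_sub_two_curv_le`** `|∂_φ² f(X − Γ(φ+θ)) − 2·D²f(Γ₀θ)[Γ₀′θ,Γ₀′θ]| ≤ K₃‖p − q‖D₁² + 2K₂D₁‖Γ′(φ+θ) − Γ₀′θ‖ + K₂‖p − q‖D₂ + K₁‖Γ″(φ+θ) − Γ₀″θ‖`;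
* §2 (sizes) `contDiff_partnerBand_angle` (`φ ↦ e_K(X − Φ(e,φ+θ))` is `C⁴`, so `C²`), **`abs_iteratedDeriv_two_partnerBand_angle_sub_two_curv_le`** (any `X`),
  **`iteratedDeriv_two_partnerBand_pp_angle_ge`** / **`_ph_`** under `FrameOK R U N μ K`:
  `(3/100)·u_min² − L ≤ ∂_φ² ē`, `L = K₃·Δ₀·D₁² + 2K₂D₁(RR₁|e| + D₂|φ|) + K₂·Δ₀·D₂ + K₁(C₂row|e| + D₃|φ|)`, `Δ₀ = (|ρ|/d + D₁|ϑ − ϑ_T|) + |e|/d + D₁|φ|` —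
  on a window where `L ≤ (3/200)u_min²` the fold hypothesis `2b ≤ ∂_φ²ē` of parts 2–3 holds with `b = (3/400)·u_min²`.

Hypotheses = those of `…C4aPartnerBandTangencyLower`.  Bookkeeping on landed objects; nothing about the model's sizes; nothing asserts superconductivity.
References: FST II CPAM 51 (1998) Lemma 2.1, §3 [cite: FeldmanSalmhoferTrubowitz1998]; BGM 2006 §2.4 (2.40) [cite: BenfattoGiulianiMastropietro2006].
-/

noncomputable section

namespace Summit.HubbardSuperconductivity.HubbardSuperconductivity.Theorems.C4a

set_option linter.dupNamespace false -- summit = problem name (single-conjunct summit), D-0017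
set_option maxSynthPendingDepth 3 -- nested operator-norm instances (third Fréchet derivatives)

open Real Set Filter
open scoped Topology
open Literature.MathematicalPhysics.QuantumLattice Literature.MathematicalPhysics.QuantumLattice.BandSectorCounting Literature.Probability.LatticeModels
open Summit.HubbardSuperconductivity.HubbardSuperconductivity.Theorems.KLRegimeSplit
open Summit.HubbardSuperconductivity.HubbardSuperconductivity.Theorems.DispersionFlow
open Summit.HubbardSuperconductivity.HubbardSuperconductivity.Theorems.PerturbedFermiCurve

/-! ## §1 Carrier-free: the loop-angle second derivative against the reference 2-jet -/

section Abstract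

variable {V : Type*} [NormedAddCommGroup V] [NormedSpace ℝ V]

/-- Chain expression: `∂_φ² f(X − Γ(φ+θ)) = D²f(p)[Γ′(φ+θ), Γ′(φ+θ)] − Df(p)[Γ″(φ+θ)]`, `p = X − Γ(φ+θ)`. [folklore] -/
theorem iteratedDeriv_two_comp_const_sub_shift {f : V → ℝ} (hf : ContDiff ℝ 4 f) {Γ : ℝ → V} (hΓ : ContDiff ℝ 4 Γ) (X : V) (θ φ : ℝ) :
    iteratedDeriv 2 (fun x : ℝ => f (X - Γ (x + θ))) φ =
      fderiv ℝ (fderiv ℝ f) (X - Γ (φ + θ)) (iteratedDeriv 1 Γ (φ + θ)) (iteratedDeriv 1 Γ (φ + θ)) -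
        fderiv ℝ f (X - Γ (φ + θ)) (iteratedDeriv 2 Γ (φ + θ)) := by
  have hshift : ContDiff ℝ 4 (fun x : ℝ => Γ (x + θ)) := hΓ.comp (contDiff_id.add contDiff_const)
  have hc : ContDiff ℝ 4 (fun x : ℝ => X - Γ (x + θ)) := contDiff_const.sub hshift
  have hcj : ∀ {j : ℕ}, 0 < j → ∀ x : ℝ, iteratedDeriv j (fun x : ℝ => X - Γ (x + θ)) x = -iteratedDeriv j Γ (x + θ) := fun {j} hj x => by
    rw [iteratedDeriv_const_sub hj, iteratedDeriv_neg, show (fun x : ℝ => Γ (x + θ)) = fun x : ℝ => Γ (x + θ) from rfl, iteratedDeriv_comp_add_const]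
  have h := iteratedDeriv_two_comp_eq hf hc φ
  rw [show (f ∘ fun x : ℝ => X - Γ (x + θ)) = fun x => f (X - Γ (x + θ)) from rfl] at h
  rw [h, hcj one_pos, hcj two_pos]
  simp only [map_neg, neg_apply, neg_neg]
  ring

/-- On a curve in the zero level of `f`: `D²f(Γ θ)[Γ′θ, Γ′θ] + Df(Γ θ)[Γ″θ] = 0` (`(f∘Γ)″ = 0`). [folklore] -/
theorem fderiv_two_add_fderiv_levelCurve_eq_zero {f : V → ℝ} (hf : ContDiff ℝ 4 f) {Γ : ℝ → V} (hΓ : ContDiff ℝ 4 Γ) (hΓ0 : ∀ s, f (Γ s) = 0) (θ : ℝ) :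
    fderiv ℝ (fderiv ℝ f) (Γ θ) (iteratedDeriv 1 Γ θ) (iteratedDeriv 1 Γ θ) + fderiv ℝ f (Γ θ) (iteratedDeriv 2 Γ θ) = 0 := by
  have hconst : f ∘ Γ = fun _ => (0 : ℝ) := funext fun s => hΓ0 s
  rw [← iteratedDeriv_two_comp_eq hf hΓ θ, hconst, iteratedDeriv_const]
  simp

/-- **THE LOOP-ANGLE CURVATURE AGAINST THE REFERENCE 2-JET** (carrier-free): `f ∈ C⁴` (`K₁,K₂,K₃`), curves `Γ, Γ₀ ∈ C⁴` with `f ∘ Γ₀ ≡ 0`,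
`‖Γ′‖, ‖Γ₀′‖ ≤ D₁`, `‖Γ″‖ ≤ D₂` ⟹ `|∂_φ² f(X − Γ(φ+θ)) − 2·D²f(Γ₀θ)[Γ₀′θ, Γ₀′θ]| ≤ K₃‖p − q‖D₁² + K₂‖Γ′(φ+θ) − Γ₀′θ‖(D₁ + D₁) + K₂‖p − q‖D₂ + K₁‖Γ″(φ+θ) − Γ₀″θ‖`
with `p − q = X − Γ(φ+θ) − Γ₀θ`. [folklore] -/
theorem abs_iteratedDeriv_two_comp_sub_two_curv_le {f : V → ℝ} (hf : ContDiff ℝ 4 f) {K₁ K₂ K₃ : ℝ} (hK₁ : ∀ x, ‖fderiv ℝ f x‖ ≤ K₁)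
    (hK₂ : ∀ x, ‖iteratedFDeriv ℝ 2 f x‖ ≤ K₂) (hK₃ : ∀ x, ‖iteratedFDeriv ℝ 3 f x‖ ≤ K₃) {Γ Γ₀ : ℝ → V} (hΓ : ContDiff ℝ 4 Γ) (hΓ₀ : ContDiff ℝ 4 Γ₀)
    (hΓ₀0 : ∀ s, f (Γ₀ s) = 0) {D₁ D₂ : ℝ} (hD₁ : ∀ s, ‖iteratedDeriv 1 Γ s‖ ≤ D₁) (hD₁' : ∀ s, ‖iteratedDeriv 1 Γ₀ s‖ ≤ D₁)
    (hD₂ : ∀ s, ‖iteratedDeriv 2 Γ s‖ ≤ D₂) (X : V) (θ φ : ℝ) :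
    |iteratedDeriv 2 (fun x : ℝ => f (X - Γ (x + θ))) φ - 2 * fderiv ℝ (fderiv ℝ f) (Γ₀ θ) (iteratedDeriv 1 Γ₀ θ) (iteratedDeriv 1 Γ₀ θ)| ≤
      K₃ * ‖X - Γ (φ + θ) - Γ₀ θ‖ * D₁ ^ 2 + K₂ * ‖iteratedDeriv 1 Γ (φ + θ) - iteratedDeriv 1 Γ₀ θ‖ * (D₁ + D₁) +
        K₂ * ‖X - Γ (φ + θ) - Γ₀ θ‖ * D₂ + K₁ * ‖iteratedDeriv 2 Γ (φ + θ) - iteratedDeriv 2 Γ₀ θ‖ := by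
  have hK₂0 : 0 ≤ K₂ := (norm_nonneg _).trans (hK₂ (Γ₀ θ))
  have hK₃0 : 0 ≤ K₃ := (norm_nonneg _).trans (hK₃ (Γ₀ θ))
  rw [iteratedDeriv_two_comp_const_sub_shift hf hΓ X θ φ]
  have href := fderiv_two_add_fderiv_levelCurve_eq_zero hf hΓ₀ hΓ₀0 θ
  -- both sides as order-2 chain expressions at the 2-jets `(p; Γ′, −Γ″)` and `(q; Γ₀′, −Γ₀″)`
  have e1 : fderiv ℝ (fderiv ℝ f) (X - Γ (φ + θ)) (iteratedDeriv 1 Γ (φ + θ)) (iteratedDeriv 1 Γ (φ + θ)) -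
        fderiv ℝ f (X - Γ (φ + θ)) (iteratedDeriv 2 Γ (φ + θ)) -
        2 * fderiv ℝ (fderiv ℝ f) (Γ₀ θ) (iteratedDeriv 1 Γ₀ θ) (iteratedDeriv 1 Γ₀ θ) =
      fderiv ℝ (fderiv ℝ f) (X - Γ (φ + θ)) (iteratedDeriv 1 Γ (φ + θ)) (iteratedDeriv 1 Γ (φ + θ)) +
          fderiv ℝ f (X - Γ (φ + θ)) (-iteratedDeriv 2 Γ (φ + θ)) -
        (fderiv ℝ (fderiv ℝ f) (Γ₀ θ) (iteratedDeriv 1 Γ₀ θ) (iteratedDeriv 1 Γ₀ θ) + fderiv ℝ f (Γ₀ θ) (-iteratedDeriv 2 Γ₀ θ)) := by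
    simp only [map_neg]
    linarith [href]
  rw [e1]
  refine (abs_jet_two_sub_le hf hK₁ hK₂ hK₃ _ _ _ _ _ _).trans ?_
  have t1 : K₃ * ‖X - Γ (φ + θ) - Γ₀ θ‖ * ‖iteratedDeriv 1 Γ (φ + θ)‖ ^ 2 ≤ K₃ * ‖X - Γ (φ + θ) - Γ₀ θ‖ * D₁ ^ 2 :=
    mul_le_mul_of_nonneg_left (pow_le_pow_left₀ (norm_nonneg _) (hD₁ _) 2) (mul_nonneg hK₃0 (norm_nonneg _))
  have t2 : K₂ * ‖iteratedDeriv 1 Γ (φ + θ) - iteratedDeriv 1 Γ₀ θ‖ * (‖iteratedDeriv 1 Γ (φ + θ)‖ + ‖iteratedDeriv 1 Γ₀ θ‖) ≤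
      K₂ * ‖iteratedDeriv 1 Γ (φ + θ) - iteratedDeriv 1 Γ₀ θ‖ * (D₁ + D₁) :=
    mul_le_mul_of_nonneg_left (add_le_add (hD₁ _) (hD₁' _)) (mul_nonneg hK₂0 (norm_nonneg _))
  have t3 : K₂ * ‖X - Γ (φ + θ) - Γ₀ θ‖ * ‖-iteratedDeriv 2 Γ (φ + θ)‖ ≤ K₂ * ‖X - Γ (φ + θ) - Γ₀ θ‖ * D₂ :=
    mul_le_mul_of_nonneg_left (by rw [norm_neg]; exact hD₂ _) (mul_nonneg hK₂0 (norm_nonneg _))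
  have t4 : ‖-iteratedDeriv 2 Γ (φ + θ) - -iteratedDeriv 2 Γ₀ θ‖ = ‖iteratedDeriv 2 Γ (φ + θ) - iteratedDeriv 2 Γ₀ θ‖ := by
    rw [neg_sub_neg, norm_sub_rev]
  rw [t4]
  linarith

end Abstract

/-! ## §2 The partner band in the loop angle: smoothness and the curvature floor under `FrameOK` -/

section Smooth

variable {K : TrigPolyC4v} {A : ℝ} (hA : ∀ p : Momentum, ∀ j ≤ 2, ‖iteratedFDeriv ℝ j (frameShift K) p‖ ≤ A)
  (hd : klCurveD ≤ (bandBounds (show (-4 : ℝ) < -1.1 by norm_num) (show (-1.1 : ℝ) ≤ -0.1 by norm_num)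
    (show (-0.1 : ℝ) < 0 by norm_num)).Dtmin - 2 * A)
  {μ r : ℝ} (hlo : (-1.1 : ℝ) < μ - r - A) (hhi : μ + r + A < -0.1)
include hA hd hlo hhi

/-- `φ ↦ e_K(X − Φ(e, φ+θ))` is `C^m` for every `m` (`|e| < r`). -/
theorem contDiff_partnerBand_angle (X : Momentum) {e : ℝ} (he : |e| < r) (θ : ℝ) {m : ℕ∞} :
    ContDiff ℝ m fun x : ℝ => frameLevel μ K (X - levelPoint μ K e (x + θ)) := by
  set B₀ := bandBounds (show (-4 : ℝ) < -1.1 by norm_num) (show (-1.1 : ℝ) ≤ -0.1 by norm_num) (show (-0.1 : ℝ) < 0 by norm_num) with hB₀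
  have hADt : 2 * A < B₀.Dtmin := by have := klCurveD_pos; linarith
  have hΓ : ContDiff ℝ m (fun x : ℝ => levelPoint μ K e (x + θ)) :=
    (contDiff_levelPoint_angle B₀ hA hADt hlo hhi he).comp (contDiff_id.add contDiff_const)
  exact (EngineV8.contDiff_frameLevel μ K).comp (contDiff_const.sub hΓ)

end Smooth

section Sizes

variable {K : TrigPolyC4v} {A : ℝ} (hA : ∀ p : Momentum, ∀ j ≤ 2, ‖iteratedFDeriv ℝ j (frameShift K) p‖ ≤ A) (hA20 : A ≤ 1 / 20)
  (hd : klCurveD ≤ (bandBounds (show (-4 : ℝ) < -1.1 by norm_num) (show (-1.1 : ℝ) ≤ -0.1 by norm_num)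
    (show (-0.1 : ℝ) < 0 by norm_num)).Dtmin - 2 * A)
  {μ r : ℝ} (hr : 0 < r) (hlo : (-1.1 : ℝ) < μ - r - A) (hhi : μ + r + A < -0.1)
  {A₃ A₄ : ℝ} (hA₃ : ∀ p : Momentum, ‖iteratedFDeriv ℝ 3 (frameShift K) p‖ ≤ A₃)
  (hA₄ : ∀ p : Momentum, ‖iteratedFDeriv ℝ 4 (frameShift K) p‖ ≤ A₄)
  {K₁ K₂ K₃ : ℝ} (hK₁ : ∀ p : Momentum, ‖fderiv ℝ (frameLevel μ K) p‖ ≤ K₁) (hK₂ : ∀ p : Momentum, ‖iteratedFDeriv ℝ 2 (frameLevel μ K) p‖ ≤ K₂)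
  (hK₃ : ∀ p : Momentum, ‖iteratedFDeriv ℝ 3 (frameLevel μ K) p‖ ≤ K₃)
include hA hA20 hd hr hlo hhi hA₃ hA₄ hK₁ hK₂ hK₃

/-- **THE LOOP-ANGLE CURVATURE OF THE PARTNER BAND AGAINST `2b_T(θ)`**, for any base point `X`: with `d = Dt_min − 2A`, `D_j = msD A₃ A₄ j`,
`RR₁ = radialRowOneConst A d`, `C₂row = uRowTwoConst A A₃ d + 1/d + 2(RR₁ − 1/d)` and `Δ₀ = ‖X − 2Φ(0,θ)‖ + |e|/d + D₁|φ|`: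
`|∂_φ² e_K(X − Φ(e,φ+θ)) − 2b_T(θ)| ≤ K₃Δ₀D₁² + K₂(RR₁|e| + D₂|φ|)(D₁ + D₁) + K₂Δ₀D₂ + K₁(C₂row|e| + D₃|φ|)`. -/
theorem abs_iteratedDeriv_two_partnerBand_angle_sub_two_curv_le (X : Momentum) {e : ℝ} (he : |e| < r) (θ φ : ℝ) :
    |iteratedDeriv 2 (fun x : ℝ => frameLevel μ K (X - levelPoint μ K e (x + θ))) φ -
        2 * fderiv ℝ (fderiv ℝ (frameLevel μ K)) (levelPoint μ K 0 θ) (iteratedDeriv 1 (levelPoint μ K 0) θ) (iteratedDeriv 1 (levelPoint μ K 0) θ)| ≤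
      K₃ * (‖X - (levelPoint μ K 0 θ + levelPoint μ K 0 θ)‖ +
            |e| / ((bandBounds (show (-4 : ℝ) < -1.1 by norm_num) (show (-1.1 : ℝ) ≤ -0.1 by norm_num) (show (-0.1 : ℝ) < 0 by norm_num)).Dtmin - 2 * A) +
            msD A₃ A₄ 1 * |φ|) * msD A₃ A₄ 1 ^ 2 +
        K₂ * (radialRowOneConst A ((bandBounds (show (-4 : ℝ) < -1.1 by norm_num) (show (-1.1 : ℝ) ≤ -0.1 by norm_num) (show (-0.1 : ℝ) < 0 by norm_num)).Dtmin - 2 * A) * |e| +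
            msD A₃ A₄ 2 * |φ|) * (msD A₃ A₄ 1 + msD A₃ A₄ 1) +
        K₂ * (‖X - (levelPoint μ K 0 θ + levelPoint μ K 0 θ)‖ +
            |e| / ((bandBounds (show (-4 : ℝ) < -1.1 by norm_num) (show (-1.1 : ℝ) ≤ -0.1 by norm_num) (show (-0.1 : ℝ) < 0 by norm_num)).Dtmin - 2 * A) +
            msD A₃ A₄ 1 * |φ|) * msD A₃ A₄ 2 +
        K₁ * ((uRowTwoConst A A₃ ((bandBounds (show (-4 : ℝ) < -1.1 by norm_num) (show (-1.1 : ℝ) ≤ -0.1 by norm_num) (show (-0.1 : ℝ) < 0 by norm_num)).Dtmin - 2 * A) +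
              1 / ((bandBounds (show (-4 : ℝ) < -1.1 by norm_num) (show (-1.1 : ℝ) ≤ -0.1 by norm_num) (show (-0.1 : ℝ) < 0 by norm_num)).Dtmin - 2 * A) +
              2 * (radialRowOneConst A ((bandBounds (show (-4 : ℝ) < -1.1 by norm_num) (show (-1.1 : ℝ) ≤ -0.1 by norm_num) (show (-0.1 : ℝ) < 0 by norm_num)).Dtmin - 2 * A) -
                1 / ((bandBounds (show (-4 : ℝ) < -1.1 by norm_num) (show (-1.1 : ℝ) ≤ -0.1 by norm_num) (show (-0.1 : ℝ) < 0 by norm_num)).Dtmin - 2 * A))) * |e| +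
            msD A₃ A₄ 3 * |φ|) := by
  set B₀ := bandBounds (show (-4 : ℝ) < -1.1 by norm_num) (show (-1.1 : ℝ) ≤ -0.1 by norm_num) (show (-0.1 : ℝ) < 0 by norm_num) with hB₀
  have hADt : 2 * A < B₀.Dtmin := by have := klCurveD_pos; linarith
  have h0 : |(0 : ℝ)| < r := by simpa using hr
  have hK₁0 : 0 ≤ K₁ := (norm_nonneg _).trans (hK₁ 0)
  have hK₂0 : 0 ≤ K₂ := (norm_nonneg _).trans (hK₂ 0)
  have hK₃0 : 0 ≤ K₃ := (norm_nonneg _).trans (hK₃ 0)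
  have hD1 := fun s => norm_iteratedDeriv_levelPoint_le hA hA20 hd hlo hhi hA₃ hA₄ he le_rfl (by norm_num) s
  have hD1' := fun s => norm_iteratedDeriv_levelPoint_le hA hA20 hd hlo hhi hA₃ hA₄ h0 le_rfl (by norm_num) s
  have hD2 := fun s => norm_iteratedDeriv_levelPoint_le hA hA20 hd hlo hhi hA₃ hA₄ he (i := 2) (by norm_num) (by norm_num) s
  have hD10 : 0 ≤ msD A₃ A₄ 1 := (norm_nonneg _).trans (hD1 0)
  have hD20 : 0 ≤ msD A₃ A₄ 2 := (norm_nonneg _).trans (hD2 0)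
  have hmain := abs_iteratedDeriv_two_comp_sub_two_curv_le (EngineV8.contDiff_frameLevel μ K) hK₁ hK₂ hK₃
    (contDiff_levelPoint_angle B₀ hA hADt hlo hhi he) (contDiff_levelPoint_angle B₀ hA hADt hlo hhi h0)
    (fun s => frameLevel_levelPoint_zero B₀ hA hr hlo hhi s) hD1 hD1' hD2 X θ φ
  -- the three displacements
  have hpq : ‖X - levelPoint μ K e (φ + θ) - levelPoint μ K 0 θ‖ ≤ ‖X - (levelPoint μ K 0 θ + levelPoint μ K 0 θ)‖ + |e| / (B₀.Dtmin - 2 * A) + msD A₃ A₄ 1 * |φ| := by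
    have e1 : X - levelPoint μ K e (φ + θ) - levelPoint μ K 0 θ =
        (X - (levelPoint μ K 0 θ + levelPoint μ K 0 θ)) + (levelPoint μ K 0 (φ + θ) - levelPoint μ K e (φ + θ)) + (levelPoint μ K 0 θ - levelPoint μ K 0 (φ + θ)) := by abel
    rw [e1]
    refine (norm_add₃_le).trans (add_le_add (add_le_add le_rfl ?_) ?_)
    · have h := norm_levelPoint_sub_levelPoint_le B₀ hA hADt hlo hhi (ρ := 0) (ρ' := e) ⟨by linarith, hr⟩ ⟨(abs_lt.1 he).1, (abs_lt.1 he).2⟩ (φ + θ)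
      rwa [zero_sub, abs_neg] at h
    · have h := norm_iteratedDeriv_levelPoint_sub_le_angle hA hA20 hd hlo hhi hA₃ hA₄ h0 (i := 0) (by norm_num) θ (φ + θ)
      simp only [iteratedDeriv_zero, zero_add] at h
      rwa [show |θ - (φ + θ)| = |φ| by rw [show θ - (φ + θ) = -φ by ring, abs_neg]] at h
  have hv1 : ‖iteratedDeriv 1 (levelPoint μ K e) (φ + θ) - iteratedDeriv 1 (levelPoint μ K 0) θ‖ ≤
      radialRowOneConst A (B₀.Dtmin - 2 * A) * |e| + msD A₃ A₄ 2 * |φ| := by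
    have e1 : iteratedDeriv 1 (levelPoint μ K e) (φ + θ) - iteratedDeriv 1 (levelPoint μ K 0) θ =
        (iteratedDeriv 1 (levelPoint μ K e) (φ + θ) - iteratedDeriv 1 (levelPoint μ K 0) (φ + θ)) +
          (iteratedDeriv 1 (levelPoint μ K 0) (φ + θ) - iteratedDeriv 1 (levelPoint μ K 0) θ) := by abel
    rw [e1]
    refine (norm_add_le _ _).trans (add_le_add (norm_iteratedDeriv_one_levelPoint_sub_le hA hd hr hlo hhi he (φ + θ)) ?_)
    have h := norm_iteratedDeriv_levelPoint_sub_le_angle hA hA20 hd hlo hhi hA₃ hA₄ h0 (i := 1) (by norm_num) (φ + θ) θ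
    rwa [show |φ + θ - θ| = |φ| by rw [add_sub_cancel_right]] at h
  have hv2 : ‖iteratedDeriv 2 (levelPoint μ K e) (φ + θ) - iteratedDeriv 2 (levelPoint μ K 0) θ‖ ≤
      (uRowTwoConst A A₃ (B₀.Dtmin - 2 * A) + 1 / (B₀.Dtmin - 2 * A) + 2 * (radialRowOneConst A (B₀.Dtmin - 2 * A) - 1 / (B₀.Dtmin - 2 * A))) * |e| +
        msD A₃ A₄ 3 * |φ| := by
    have e1 : iteratedDeriv 2 (levelPoint μ K e) (φ + θ) - iteratedDeriv 2 (levelPoint μ K 0) θ =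
        (iteratedDeriv 2 (levelPoint μ K e) (φ + θ) - iteratedDeriv 2 (levelPoint μ K 0) (φ + θ)) +
          (iteratedDeriv 2 (levelPoint μ K 0) (φ + θ) - iteratedDeriv 2 (levelPoint μ K 0) θ) := by abel
    rw [e1]
    refine (norm_add_le _ _).trans (add_le_add (norm_iteratedDeriv_two_levelPoint_sub_le hA hA20 hd hr hlo hhi hA₃ hA₄ he (φ + θ)) ?_)
    have h := norm_iteratedDeriv_levelPoint_sub_le_angle hA hA20 hd hlo hhi hA₃ hA₄ h0 (i := 2) (by norm_num) (φ + θ) θ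
    rwa [show |φ + θ - θ| = |φ| by rw [add_sub_cancel_right]] at h
  refine hmain.trans ?_
  have s1 : K₃ * ‖X - levelPoint μ K e (φ + θ) - levelPoint μ K 0 θ‖ * msD A₃ A₄ 1 ^ 2 ≤
      K₃ * (‖X - (levelPoint μ K 0 θ + levelPoint μ K 0 θ)‖ + |e| / (B₀.Dtmin - 2 * A) + msD A₃ A₄ 1 * |φ|) * msD A₃ A₄ 1 ^ 2 :=
    mul_le_mul_of_nonneg_right (mul_le_mul_of_nonneg_left hpq hK₃0) (sq_nonneg _)
  have s2 : K₂ * ‖iteratedDeriv 1 (levelPoint μ K e) (φ + θ) - iteratedDeriv 1 (levelPoint μ K 0) θ‖ * (msD A₃ A₄ 1 + msD A₃ A₄ 1) ≤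
      K₂ * (radialRowOneConst A (B₀.Dtmin - 2 * A) * |e| + msD A₃ A₄ 2 * |φ|) * (msD A₃ A₄ 1 + msD A₃ A₄ 1) :=
    mul_le_mul_of_nonneg_right (mul_le_mul_of_nonneg_left hv1 hK₂0) (add_nonneg hD10 hD10)
  have s3 : K₂ * ‖X - levelPoint μ K e (φ + θ) - levelPoint μ K 0 θ‖ * msD A₃ A₄ 2 ≤
      K₂ * (‖X - (levelPoint μ K 0 θ + levelPoint μ K 0 θ)‖ + |e| / (B₀.Dtmin - 2 * A) + msD A₃ A₄ 1 * |φ|) * msD A₃ A₄ 2 :=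
    mul_le_mul_of_nonneg_right (mul_le_mul_of_nonneg_left hpq hK₂0) hD20
  have s4 : K₁ * ‖iteratedDeriv 2 (levelPoint μ K e) (φ + θ) - iteratedDeriv 2 (levelPoint μ K 0) θ‖ ≤
      K₁ * ((uRowTwoConst A A₃ (B₀.Dtmin - 2 * A) + 1 / (B₀.Dtmin - 2 * A) + 2 * (radialRowOneConst A (B₀.Dtmin - 2 * A) - 1 / (B₀.Dtmin - 2 * A))) * |e| +
        msD A₃ A₄ 3 * |φ|) := mul_le_mul_of_nonneg_left hv2 hK₁0
  linarith

/-- **CURVATURE FLOOR OF THE pp PARTNER BAND NEAR TANGENCY under `FrameOK`** (`X = S_{ρϑθ}(0)`, `‖X − 2Φ(0,θ)‖ ≤ |ρ|/d + D₁|ϑ|`):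
`(3/100)·u_min² − L(|φ|, |e|, |ρ|, |ϑ|) ≤ ∂_φ² e_K(S_{ρϑθ}(0) − Φ(e, φ+θ))`. -/
theorem iteratedDeriv_two_partnerBand_pp_angle_ge {R : RenConsts} {U : ℝ} {N : ℕ} (hF : FrameOK R U N μ K) {ρ : ℝ} (hρ : |ρ| < r)
    {e : ℝ} (he : |e| < r) (ϑ θ φ : ℝ) :
    2 * (3 / 200 * (bandBounds (show (-4 : ℝ) < -1.1 by norm_num) (show (-1.1 : ℝ) ≤ -0.1 by norm_num) (show (-0.1 : ℝ) < 0 by norm_num)).umin ^ 2) -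
        (K₃ * (|ρ| / ((bandBounds (show (-4 : ℝ) < -1.1 by norm_num) (show (-1.1 : ℝ) ≤ -0.1 by norm_num) (show (-0.1 : ℝ) < 0 by norm_num)).Dtmin - 2 * A) +
              msD A₃ A₄ 1 * |ϑ| +
            |e| / ((bandBounds (show (-4 : ℝ) < -1.1 by norm_num) (show (-1.1 : ℝ) ≤ -0.1 by norm_num) (show (-0.1 : ℝ) < 0 by norm_num)).Dtmin - 2 * A) +
            msD A₃ A₄ 1 * |φ|) * msD A₃ A₄ 1 ^ 2 +
        K₂ * (radialRowOneConst A ((bandBounds (show (-4 : ℝ) < -1.1 by norm_num) (show (-1.1 : ℝ) ≤ -0.1 by norm_num) (show (-0.1 : ℝ) < 0 by norm_num)).Dtmin - 2 * A) * |e| +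
            msD A₃ A₄ 2 * |φ|) * (msD A₃ A₄ 1 + msD A₃ A₄ 1) +
        K₂ * (|ρ| / ((bandBounds (show (-4 : ℝ) < -1.1 by norm_num) (show (-1.1 : ℝ) ≤ -0.1 by norm_num) (show (-0.1 : ℝ) < 0 by norm_num)).Dtmin - 2 * A) +
              msD A₃ A₄ 1 * |ϑ| +
            |e| / ((bandBounds (show (-4 : ℝ) < -1.1 by norm_num) (show (-1.1 : ℝ) ≤ -0.1 by norm_num) (show (-0.1 : ℝ) < 0 by norm_num)).Dtmin - 2 * A) +
            msD A₃ A₄ 1 * |φ|) * msD A₃ A₄ 2 +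
        K₁ * ((uRowTwoConst A A₃ ((bandBounds (show (-4 : ℝ) < -1.1 by norm_num) (show (-1.1 : ℝ) ≤ -0.1 by norm_num) (show (-0.1 : ℝ) < 0 by norm_num)).Dtmin - 2 * A) +
              1 / ((bandBounds (show (-4 : ℝ) < -1.1 by norm_num) (show (-1.1 : ℝ) ≤ -0.1 by norm_num) (show (-0.1 : ℝ) < 0 by norm_num)).Dtmin - 2 * A) +
              2 * (radialRowOneConst A ((bandBounds (show (-4 : ℝ) < -1.1 by norm_num) (show (-1.1 : ℝ) ≤ -0.1 by norm_num) (show (-0.1 : ℝ) < 0 by norm_num)).Dtmin - 2 * A) -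
                1 / ((bandBounds (show (-4 : ℝ) < -1.1 by norm_num) (show (-1.1 : ℝ) ≤ -0.1 by norm_num) (show (-0.1 : ℝ) < 0 by norm_num)).Dtmin - 2 * A))) * |e| +
            msD A₃ A₄ 3 * |φ|)) ≤
      iteratedDeriv 2 (fun x : ℝ => frameLevel μ K (pairSumPath μ K ρ ϑ θ 0 - levelPoint μ K e (x + θ))) φ := by
  set B₀ := bandBounds (show (-4 : ℝ) < -1.1 by norm_num) (show (-1.1 : ℝ) ≤ -0.1 by norm_num) (show (-0.1 : ℝ) < 0 by norm_num) with hB₀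
  have hK₂0 : 0 ≤ K₂ := (norm_nonneg _).trans (hK₂ 0)
  have hK₃0 : 0 ≤ K₃ := (norm_nonneg _).trans (hK₃ 0)
  have hD1 := fun s => norm_iteratedDeriv_levelPoint_le hA hA20 hd hlo hhi hA₃ hA₄ he le_rfl (by norm_num) s
  have hD2 := fun s => norm_iteratedDeriv_levelPoint_le hA hA20 hd hlo hhi hA₃ hA₄ he (i := 2) (by norm_num) (by norm_num) s
  have hD10 : 0 ≤ msD A₃ A₄ 1 := (norm_nonneg _).trans (hD1 0)
  have hD20 : 0 ≤ msD A₃ A₄ 2 := (norm_nonneg _).trans (hD2 0)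
  have hmain := abs_iteratedDeriv_two_partnerBand_angle_sub_two_curv_le hA hA20 hd hr hlo hhi hA₃ hA₄ hK₁ hK₂ hK₃ (pairSumPath μ K ρ ϑ θ 0) he θ φ
  have hX : ‖pairSumPath μ K ρ ϑ θ 0 - (levelPoint μ K 0 θ + levelPoint μ K 0 θ)‖ ≤ |ρ| / (B₀.Dtmin - 2 * A) + msD A₃ A₄ 1 * |ϑ| := by
    rw [show pairSumPath μ K ρ ϑ θ 0 - (levelPoint μ K 0 θ + levelPoint μ K 0 θ) = -pairDiffPath μ K ρ ϑ θ 0 by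
      simp only [pairSumPath, pairDiffPath, add_zero]; abel, norm_neg]
    exact norm_pairDiffPath_zero_le hA hA20 hd hr hlo hhi hA₃ hA₄ hρ ϑ θ
  have hb := curvCoeff_ge_umin_sq_of_frameOK hA hd hr hlo hhi hF θ
  have s1 : K₃ * (‖pairSumPath μ K ρ ϑ θ 0 - (levelPoint μ K 0 θ + levelPoint μ K 0 θ)‖ + |e| / (B₀.Dtmin - 2 * A) + msD A₃ A₄ 1 * |φ|) * msD A₃ A₄ 1 ^ 2 ≤
      K₃ * (|ρ| / (B₀.Dtmin - 2 * A) + msD A₃ A₄ 1 * |ϑ| + |e| / (B₀.Dtmin - 2 * A) + msD A₃ A₄ 1 * |φ|) * msD A₃ A₄ 1 ^ 2 :=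
    mul_le_mul_of_nonneg_right (mul_le_mul_of_nonneg_left (by linarith) hK₃0) (sq_nonneg _)
  have s3 : K₂ * (‖pairSumPath μ K ρ ϑ θ 0 - (levelPoint μ K 0 θ + levelPoint μ K 0 θ)‖ + |e| / (B₀.Dtmin - 2 * A) + msD A₃ A₄ 1 * |φ|) * msD A₃ A₄ 2 ≤
      K₂ * (|ρ| / (B₀.Dtmin - 2 * A) + msD A₃ A₄ 1 * |ϑ| + |e| / (B₀.Dtmin - 2 * A) + msD A₃ A₄ 1 * |φ|) * msD A₃ A₄ 2 :=
    mul_le_mul_of_nonneg_right (mul_le_mul_of_nonneg_left (by linarith) hK₂0) hD20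
  have habs := abs_le.1 hmain
  linarith [habs.1]

/-- **CURVATURE FLOOR OF THE ph PARTNER BAND NEAR `2k_F` under `FrameOK`** (`e_K` even: `e_K(Φ(e,φ+θ) − D) = e_K(D − Φ(e,φ+θ))`, `X = D_{ρϑθ}(0)`,
`‖X − 2Φ(0,θ)‖ ≤ |ρ|/d + D₁|ϑ − π|`): `(3/100)·u_min² − L(|φ|, |e|, |ρ|, |ϑ − π|) ≤ ∂_φ² e_K(Φ(e, φ+θ) − D_{ρϑθ}(0))`. -/
theorem iteratedDeriv_two_partnerBand_ph_angle_ge {R : RenConsts} {U : ℝ} {N : ℕ} (hF : FrameOK R U N μ K) {ρ : ℝ} (hρ : |ρ| < r)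
    {e : ℝ} (he : |e| < r) (ϑ θ φ : ℝ) :
    2 * (3 / 200 * (bandBounds (show (-4 : ℝ) < -1.1 by norm_num) (show (-1.1 : ℝ) ≤ -0.1 by norm_num) (show (-0.1 : ℝ) < 0 by norm_num)).umin ^ 2) -
        (K₃ * (|ρ| / ((bandBounds (show (-4 : ℝ) < -1.1 by norm_num) (show (-1.1 : ℝ) ≤ -0.1 by norm_num) (show (-0.1 : ℝ) < 0 by norm_num)).Dtmin - 2 * A) +
              msD A₃ A₄ 1 * |ϑ - π| +
            |e| / ((bandBounds (show (-4 : ℝ) < -1.1 by norm_num) (show (-1.1 : ℝ) ≤ -0.1 by norm_num) (show (-0.1 : ℝ) < 0 by norm_num)).Dtmin - 2 * A) +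
            msD A₃ A₄ 1 * |φ|) * msD A₃ A₄ 1 ^ 2 +
        K₂ * (radialRowOneConst A ((bandBounds (show (-4 : ℝ) < -1.1 by norm_num) (show (-1.1 : ℝ) ≤ -0.1 by norm_num) (show (-0.1 : ℝ) < 0 by norm_num)).Dtmin - 2 * A) * |e| +
            msD A₃ A₄ 2 * |φ|) * (msD A₃ A₄ 1 + msD A₃ A₄ 1) +
        K₂ * (|ρ| / ((bandBounds (show (-4 : ℝ) < -1.1 by norm_num) (show (-1.1 : ℝ) ≤ -0.1 by norm_num) (show (-0.1 : ℝ) < 0 by norm_num)).Dtmin - 2 * A) +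
              msD A₃ A₄ 1 * |ϑ - π| +
            |e| / ((bandBounds (show (-4 : ℝ) < -1.1 by norm_num) (show (-1.1 : ℝ) ≤ -0.1 by norm_num) (show (-0.1 : ℝ) < 0 by norm_num)).Dtmin - 2 * A) +
            msD A₃ A₄ 1 * |φ|) * msD A₃ A₄ 2 +
        K₁ * ((uRowTwoConst A A₃ ((bandBounds (show (-4 : ℝ) < -1.1 by norm_num) (show (-1.1 : ℝ) ≤ -0.1 by norm_num) (show (-0.1 : ℝ) < 0 by norm_num)).Dtmin - 2 * A) +
              1 / ((bandBounds (show (-4 : ℝ) < -1.1 by norm_num) (show (-1.1 : ℝ) ≤ -0.1 by norm_num) (show (-0.1 : ℝ) < 0 by norm_num)).Dtmin - 2 * A) +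
              2 * (radialRowOneConst A ((bandBounds (show (-4 : ℝ) < -1.1 by norm_num) (show (-1.1 : ℝ) ≤ -0.1 by norm_num) (show (-0.1 : ℝ) < 0 by norm_num)).Dtmin - 2 * A) -
                1 / ((bandBounds (show (-4 : ℝ) < -1.1 by norm_num) (show (-1.1 : ℝ) ≤ -0.1 by norm_num) (show (-0.1 : ℝ) < 0 by norm_num)).Dtmin - 2 * A))) * |e| +
            msD A₃ A₄ 3 * |φ|)) ≤
      iteratedDeriv 2 (fun x : ℝ => frameLevel μ K (levelPoint μ K e (x + θ) - pairDiffPath μ K ρ ϑ θ 0)) φ := by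
  set B₀ := bandBounds (show (-4 : ℝ) < -1.1 by norm_num) (show (-1.1 : ℝ) ≤ -0.1 by norm_num) (show (-0.1 : ℝ) < 0 by norm_num) with hB₀
  have hK₂0 : 0 ≤ K₂ := (norm_nonneg _).trans (hK₂ 0)
  have hK₃0 : 0 ≤ K₃ := (norm_nonneg _).trans (hK₃ 0)
  have hD1 := fun s => norm_iteratedDeriv_levelPoint_le hA hA20 hd hlo hhi hA₃ hA₄ he le_rfl (by norm_num) s
  have hD2 := fun s => norm_iteratedDeriv_levelPoint_le hA hA20 hd hlo hhi hA₃ hA₄ he (i := 2) (by norm_num) (by norm_num) s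
  have hD10 : 0 ≤ msD A₃ A₄ 1 := (norm_nonneg _).trans (hD1 0)
  have hD20 : 0 ≤ msD A₃ A₄ 2 := (norm_nonneg _).trans (hD2 0)
  -- `e_K` is even: flip the argument
  have hflip : (fun x : ℝ => frameLevel μ K (levelPoint μ K e (x + θ) - pairDiffPath μ K ρ ϑ θ 0)) =
      fun x : ℝ => frameLevel μ K (pairDiffPath μ K ρ ϑ θ 0 - levelPoint μ K e (x + θ)) := by
    funext x
    rw [show levelPoint μ K e (x + θ) - pairDiffPath μ K ρ ϑ θ 0 = -(pairDiffPath μ K ρ ϑ θ 0 - levelPoint μ K e (x + θ)) by abel, frameLevel_neg]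
  rw [hflip]
  have hmain := abs_iteratedDeriv_two_partnerBand_angle_sub_two_curv_le hA hA20 hd hr hlo hhi hA₃ hA₄ hK₁ hK₂ hK₃ (pairDiffPath μ K ρ ϑ θ 0) he θ φ
  have hX : ‖pairDiffPath μ K ρ ϑ θ 0 - (levelPoint μ K 0 θ + levelPoint μ K 0 θ)‖ ≤ |ρ| / (B₀.Dtmin - 2 * A) + msD A₃ A₄ 1 * |ϑ - π| := by
    rw [show pairDiffPath μ K ρ ϑ θ 0 - (levelPoint μ K 0 θ + levelPoint μ K 0 θ) = -pairSumPath μ K ρ ϑ θ 0 by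
      simp only [pairSumPath, pairDiffPath, add_zero]; abel, norm_neg]
    exact norm_pairSumPath_zero_le hA hA20 hd hr hlo hhi hA₃ hA₄ hρ ϑ θ
  have hb := curvCoeff_ge_umin_sq_of_frameOK hA hd hr hlo hhi hF θ
  have s1 : K₃ * (‖pairDiffPath μ K ρ ϑ θ 0 - (levelPoint μ K 0 θ + levelPoint μ K 0 θ)‖ + |e| / (B₀.Dtmin - 2 * A) + msD A₃ A₄ 1 * |φ|) * msD A₃ A₄ 1 ^ 2 ≤
      K₃ * (|ρ| / (B₀.Dtmin - 2 * A) + msD A₃ A₄ 1 * |ϑ - π| + |e| / (B₀.Dtmin - 2 * A) + msD A₃ A₄ 1 * |φ|) * msD A₃ A₄ 1 ^ 2 :=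
    mul_le_mul_of_nonneg_right (mul_le_mul_of_nonneg_left (by linarith) hK₃0) (sq_nonneg _)
  have s3 : K₂ * (‖pairDiffPath μ K ρ ϑ θ 0 - (levelPoint μ K 0 θ + levelPoint μ K 0 θ)‖ + |e| / (B₀.Dtmin - 2 * A) + msD A₃ A₄ 1 * |φ|) * msD A₃ A₄ 2 ≤
      K₂ * (|ρ| / (B₀.Dtmin - 2 * A) + msD A₃ A₄ 1 * |ϑ - π| + |e| / (B₀.Dtmin - 2 * A) + msD A₃ A₄ 1 * |φ|) * msD A₃ A₄ 2 :=
    mul_le_mul_of_nonneg_right (mul_le_mul_of_nonneg_left (by linarith) hK₂0) hD20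
  have habs := abs_le.1 hmain
  linarith [habs.1]

end Sizes

end Summit.HubbardSuperconductivity.HubbardSuperconductivity.Theorems.C4a

end
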